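import Literature.Probability.Percolation.StaircaseCorridor
import Literature.Probability.Percolation.StaircaseCells
import Mathlib.Tactic.Ring
import HarnessLib

/-!
# Staircase corridors from a row of lifted keys

Topic: Probability / Percolation; family `crit-perc`. A brick of the GENERIC landing layer of
Nolin's arm-separation theorem (Nolin 2008, Thm. 11, §4.4 [arXiv 0711.4948: Thm. 10, p. 12,
Fig. 6: "RSW in corridors"]), towards
`Literature.Probability.Percolation.Nolin2008_prop17_quasiMult` (`FiveArmExponentFacts.lean`).

The corridor data (`Staircase.CorridorData`, `StaircaseCorridor.lean`) of ONE exit, read off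
its column of the level table (`StaircaseTable.lean`): a sequence of lifted integer keys
`pos ℓ`, one per level. Keys live on the circle of the `C = 6m` USABLE cells of the lowest ring
— `m = n₀ - 4` per side, the ranks `2 … n₀ - 3`, two cells away from every corner (so that the
level connectors stay inside the sector of their side) — and are read modulo `C`
(`Staircase.keySide`, `Staircase.keyRank`, `StaircaseCells.lean`); the rank on the ring of the
level `ℓ` (radius `r₀ + q ℓ · s`) is `upIdx (q ℓ)` of the rank on the lowest ring. The resulting
data are well formed (`CorridorData.WF`) for ANY key sequence (`Staircase.ofKeys_wf`), so the
corridor is a chain of crossing tubes (`Staircase.isChain_corridor`).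

## Main definitions

* `Staircase.keyCellSide m x`, `Staircase.keyCellRank m x` — the usable cell of the key `x`;
* `Staircase.ofKeys` — the corridor data of a key sequence.

## Main results

* `Staircase.keyCellSide_lt`, `Staircase.keyCellRank_bounds`, `Staircase.ofKeys_wf`,
  `Staircase.ofKeys_g`, `Staircase.ofKeys_g'`.

## References

* P. Nolin, *Near-critical percolation in two dimensions*, Electron. J. Probab. 13 (2008), §4.4
  (arXiv 0711.4948: proof of Thm. 10, p. 12, Fig. 6). [Nolin2008]
-/

noncomputable section

namespace Literature.Probability.Percolation

open LatticeModels Tube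

namespace Staircase

/-- The side of the usable cell of the lifted key `x` (`m` usable cells per side). [folklore] -/
def keyCellSide (m : ℕ) (x : ℤ) : ℕ := keySide m x

/-- The rank, on the lowest ring, of the usable cell of the lifted key `x`: two cells past the
corner at least. [folklore] -/
def keyCellRank (m : ℕ) (x : ℤ) : ℕ := keyRank m x + 2

variable {m : ℕ}

/-- The side of a usable cell is `< 6`. [folklore] -/
theorem keyCellSide_lt (hm : 0 < m) (x : ℤ) : keyCellSide m x < 6 := keySide_lt hm x

/-- The rank of a usable cell is in `[2, m + 2)`. [folklore] -/
theorem keyCellRank_bounds (hm : 0 < m) (x : ℤ) : 2 ≤ keyCellRank m x ∧ keyCellRank m x < m + 2 := by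
  unfold keyCellRank
  have := keyRank_lt hm x
  omega

/-- **The corridor data of a key sequence**: lowest radius `r₀ = n₀ s` with `n₀ = m + 4`
chunks per side, `q ℓ` more chunks at the level `ℓ`, tube half-width `e`, connector half-width
`e'`; the arc of the level `ℓ` runs from the cell of `pos ℓ` to the cell of `pos (ℓ + 1)`,
clockwise iff the key decreases. [cite: Nolin2008, §4.4 (arXiv 0711.4948: proof of Thm. 10, p. 12, Fig. 6)] -/
def ofKeys (m s e e' : ℕ) (q : ℕ → ℕ) (pos : ℕ → ℤ) : CorridorData where
  r ℓ := (m + 4) * s + q ℓ * s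
  e := e
  s := s
  e' := e'
  i ℓ := keyCellSide m (pos ℓ)
  j ℓ := upIdx (q ℓ) (keyCellSide m (pos ℓ)) (keyCellRank m (pos ℓ))
  i' ℓ := keyCellSide m (pos (ℓ + 1))
  j' ℓ := upIdx (q ℓ) (keyCellSide m (pos (ℓ + 1))) (keyCellRank m (pos (ℓ + 1)))
  cw ℓ := decide (pos (ℓ + 1) < pos ℓ)

variable {s e e' : ℕ} {q : ℕ → ℕ} {pos : ℕ → ℤ}

/-- Chunks per side at the level `ℓ`: `n₀ + q ℓ`. [folklore] -/
theorem ofKeys_n (hs : 1 ≤ s) (ℓ : ℕ) : (ofKeys m s e e' q pos).n ℓ = m + 4 + q ℓ := by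
  show ((m + 4) * s + q ℓ * s) / s = m + 4 + q ℓ
  rw [← Nat.add_mul, Nat.mul_div_cancel _ (by omega)]

/-- **The data of a key sequence are well formed** on any number of levels (`1 ≤ s`, `1 ≤ m`,
`e ≤ e'`, `2e' ≤ s`, `q` non-decreasing). [folklore] -/
theorem ofKeys_wf (hs : 1 ≤ s) (hm : 1 ≤ m) (hee' : e ≤ e') (hes : 2 * e' ≤ s) (hq : ∀ ℓ, q ℓ ≤ q (ℓ + 1)) (L : ℕ) :
    (ofKeys m s e e' q pos).WF L := by
  have hn := ofKeys_n (m := m) (e := e) (e' := e') (q := q) (pos := pos) hs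
  have hdiv : ∀ ℓ, (ofKeys m s e e' q pos).r ℓ / (ofKeys m s e e' q pos).s = m + 4 + q ℓ := hn
  refine ⟨hs, hee', hes, fun ℓ _ => ?_, fun ℓ _ => ?_, fun ℓ _ => keyCellSide_lt (by omega) _,
    fun ℓ _ => keyCellSide_lt (by omega) _, fun ℓ _ => ?_, fun ℓ _ => ?_, fun ℓ _ => ?_⟩
  · show s ∣ (m + 4) * s + q ℓ * s
    exact dvd_add (dvd_mul_left _ _) (dvd_mul_left _ _)
  · rw [hdiv]; omega
  · rw [hdiv]
    show upIdx (q ℓ) (keyCellSide m (pos ℓ)) (keyCellRank m (pos ℓ)) < m + 4 + q ℓ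
    have := (keyCellRank_bounds (by omega : 0 < m) (pos ℓ)).2
    exact upIdx_lt (n₀ := m + 4) (by omega)
  · rw [hdiv]
    show upIdx (q ℓ) (keyCellSide m (pos (ℓ + 1))) (keyCellRank m (pos (ℓ + 1))) < m + 4 + q ℓ
    have := (keyCellRank_bounds (by omega : 0 < m) (pos (ℓ + 1))).2
    exact upIdx_lt (n₀ := m + 4) (by omega)
  · refine ⟨q (ℓ + 1) - q ℓ, ?_, rfl, ?_⟩
    · show (m + 4) * s + q (ℓ + 1) * s = (m + 4) * s + q ℓ * s + (q (ℓ + 1) - q ℓ) * s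
      have h := hq ℓ
      obtain ⟨d, hd⟩ := Nat.exists_eq_add_of_le h
      rw [hd, Nat.add_sub_cancel_left]
      ring
    · show upIdx (q (ℓ + 1)) (keyCellSide m (pos (ℓ + 1))) (keyCellRank m (pos (ℓ + 1))) =
        upIdx (q (ℓ + 1) - q ℓ) (keyCellSide m (pos (ℓ + 1))) (upIdx (q ℓ) (keyCellSide m (pos (ℓ + 1))) (keyCellRank m (pos (ℓ + 1))))
      rw [← upIdx_add, Nat.add_sub_cancel' (hq ℓ)]

/-- The start position of the arc of the level `ℓ` is the cell of `pos ℓ`, `q ℓ` levels up. [folklore] -/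
theorem ofKeys_g (hs : 1 ≤ s) (ℓ : ℕ) :
    (ofKeys m s e e' q pos).g ℓ = cellPos (m + 4) (q ℓ) (keyCellSide m (pos ℓ)) (keyCellRank m (pos ℓ)) := by
  show extPos ((ofKeys m s e e' q pos).n ℓ) _ _ = _
  rw [ofKeys_n hs]; rfl

/-- The end position of the arc of the level `ℓ` is the cell of `pos (ℓ + 1)`, `q ℓ` levels up. [folklore] -/
theorem ofKeys_g' (hs : 1 ≤ s) (ℓ : ℕ) :
    (ofKeys m s e e' q pos).g' ℓ = cellPos (m + 4) (q ℓ) (keyCellSide m (pos (ℓ + 1))) (keyCellRank m (pos (ℓ + 1))) := by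
  show extPos ((ofKeys m s e e' q pos).n ℓ) _ _ = _
  rw [ofKeys_n hs]; rfl

/-- **The corridor of a key sequence is a chain of crossing tubes** (`1 ≤ s`, `1 ≤ m`, `e ≤ e'`,
`2e' ≤ s`, `q` non-decreasing). [cite: Nolin2008, §4.4 (arXiv 0711.4948: proof of Thm. 10, p. 12, Fig. 6)] -/
theorem isChain_corridor_ofKeys (hs : 1 ≤ s) (hm : 1 ≤ m) (hee' : e ≤ e') (hes : 2 * e' ≤ s) (hq : ∀ ℓ, q ℓ ≤ q (ℓ + 1))
    (ℓ n : ℕ) : List.IsChain Crosses (corridor (ofKeys m s e e' q pos) ℓ n) :=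
  isChain_corridor (ofKeys_wf hs hm hee' hes hq (ℓ + n + 1)) ℓ n (by omega)

end Staircase

end Literature.Probability.Percolation
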